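import Literature.Barriers.NavierStokesRegularity.HypodissipativeLerayNonuniquenessCDLDRHolds
import Literature.Barriers.NavierStokesRegularity.HypodissipativeLerayNonuniquenessDeRosaHolds
import HarnessLib

/-!
# Barrier audit (D-0021): the exact uniqueness principles refuted by Colombo–De Lellis–De Rosa 2018 /
# De Rosa 2019, and what the entry `HypodissipativeLerayNonuniqueness` does NOT cover

Audit companion (refuter barrier audit, 2026-08-16) of the catalogue entry
`Literature.Barriers.NavierStokesRegularity.HypodissipativeLerayNonuniqueness` (L. De Rosa,
*Infinitely many Leray–Hopf solutions for the fractional Navier–Stokes equations*, Comm. PDE 44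
(2019) = arXiv:1801.10235, Thm. 1.2; M. Colombo, C. De Lellis, L. De Rosa, Comm. Math. Phys. 362
(2018) = arXiv:1708.05666, Thms. 1.2–1.3). Verdict: formal content CONFIRMED in the strongest
sense — it is a kernel theorem of the tree (`DeRosa2019_thm12_holds`,
`ColomboDeLellisDeRosa2018_thm13_holds`; axioms `propext`, `Classical.choice`, `Quot.sound`) — and
the printed range is current; the CLAIMED COVERAGE of the structured block (technique class
"… uniqueness (or a selection principle) …", tag `leray-hopf-energy-inequality-selection`, and the
`blocks:` sentence on the "global regularity ⇒ uniqueness" route) is broader than what the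
theorems refute, in two layers, recorded below; three literature updates sharpen the scope.

* **What the theorems refute (exactly).** UNIQUENESS of Leray solutions — distributional
  solutions with datum in `L^∞(ℝ⁺;L²) ∩ L²_loc(ℝ⁺;H^α)` obeying the energy inequality (2) from
  `0` and (3) from a.e. `s` — from a GENERAL divergence-free `L²` datum on `𝕋³`, for each
  `α ∈ (0, 1/3)`: `HypodissipativeLerayNonuniquenessNarrow` below (unconditional, from
  `DeRosa2019_thm12_holds`); and, locally in time and for `α < 1/5` in the tree (`α < 1/3` in
  print, [cite: Derosa2018, §1 Thm. 1.2 (a)]), uniqueness on a slab `[0,T]` even among solutions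
  that are continuous on `[0,T] × 𝕋³`, uniformly `β`-Hölder in space (`α < β < 1/5`), attain the
  `C^β` datum exactly, and satisfy the STRONG energy inequality for ALL pairs of times
  `0 ≤ s ≤ t ≤ T`: `HypodissipativeLerayNonuniquenessNarrow_local` (from
  `ColomboDeLellisDeRosa2018_thm13_holds`). So neither "energy inequality from every time" nor
  "continuity / Hölder regularity below `1/3`" is an evasion. The wild data are `C^β` with
  `α < β < 1/3` [cite: Derosa2018, §1 Thm. 1.2] — the supercritical Hölder regime `β + 2α < 1`
  [cite: BulutHuynhPalasek2022, §1 (after Thm. 1): "`L^∞_t C^β_x` is supercritical for the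
  `γ`-hypodissipative Navier–Stokes equations when `β + 2γ < 1`"] — and the distinct solutions
  separate at times accumulating at `0` [cite: Derosa2018, §2, proof of Thm. 1.2, property (v) of
  the family `𝓔_K`, p. 5]; inside `α < 1/3` the set of such wild data is even `L²`-dense
  [cite: Gorini2023, §1 Cor. (density, Hölder solutions) and Thm. (density, Sobolev solutions)].
* **Not covered (1): exponent-blind energy arguments in the presence of a strong solution.** The
  technique class is worded "arguments that would derive uniqueness … from the ingredients of
  Leray's existence theory alone: the distributional formulation, the class
  `L^∞_t L²_x ∩ L²_t H^α_x` and the energy inequalities (2)–(3)". Read literally it contains a TRUE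
  theorem: weak–strong uniqueness by the relative-energy method uses exactly the weak formulation
  and the global energy inequality from time `0`, and holds with NO dissipation at all — "Let
  `u ∈ L^∞((0,T);L²(𝕋^d))` be a weak solution and `U ∈ C¹(𝕋^d × [0,T])` a strong solution of
  [Euler] … same initial datum … [global admissibility]. Then `u = U` a.e."
  [cite: Wiedemann2018, §2 Thm. 1]; "In the class of admissible solutions, weak-strong uniqueness
  holds" [cite: Gorini2023, §1 p. 2] — the dissipative term only adds a favourable sign for every
  `α ≥ 0`. Hence the class the barrier can block is: exponent-blind uniqueness arguments for data
  from which NO Lipschitz (strong) solution emanates; consistently, the wild data of the theorems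
  admit no `C¹` solution on any slab `[0,T]`, since the distinct solutions separate at times
  accumulating at `0`. In particular the `blocks:` sentence "a uniqueness theorem
  for Leray–Hopf solutions would follow from global regularity of Leray–Hopf solutions via
  weak–strong uniqueness — so exponent-blind energy-class arguments cannot deliver that route"
  conflates data classes: global regularity FROM SMOOTH DATA plus weak–strong uniqueness yields
  uniqueness of Leray–Hopf solutions FROM SMOOTH DATA, a statement these theorems do not refute
  at any `α` (global regularity of the hypodissipative system from smooth data is open for every
  `α < 5/4`, [cite: KwonOzanski2022, §1 p. 3: "In the case of `s < 5/4`, the existence of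
  global-in-time classical solution remains open"]); what they do refute is uniqueness from
  rough data, the regime of the in-tree open problem `Literature.Analysis.FluidPDE.LerayHopfNonUniqueness`
  (ns.S19: an `L²` datum — on `ℝ³`, whereas the entry is on `𝕋³`).
* **Not covered (2): selection principles.** Non-uniqueness is not the failure of an energy-based
  SELECTION rule. The constructions realise, from one datum, every admissible kinetic-energy
  profile of the scheme ("given any two energy profiles `e₁` and `e₂` such that `e₁(0) = e₂(0)`,
  then the two corresponding solutions … start from the same initial data"
  [cite: Derosa2018, §2 Thm. 2.1]; "to ensure that one can impose the same initial data to
  infinitely many solutions" [cite: ColomboDelellisDerosa2018, §1 p. 4]); nothing printed shows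
  that a rule such as maximal dissipation rate, the vanishing-hyperviscosity limit, or the limit
  of Leray's regularised / Galerkin approximations fails to single out one Leray solution, nor
  that two of the constructed solutions share one energy profile. The tag
  `leray-hopf-energy-inequality-selection` and "(or a selection principle)" overstate the entry.
* **Outside the class (not a gap): the local energy inequality.** Arguments through suitable weak
  solutions / partial regularity are not exponent-blind: below `s = 3/4` the local energy
  inequality cannot even be formulated in the energy class ("If `s < 3/4` then it is not clear how
  one should interpret the local energy inequality … the existence of suitable weak solutions is
  not clear if `s ≤ 3/4`" [cite: KwonOzanski2022, §1 p. 6]); such arguments use the strength of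
  the dissipation and are untouched by the entry (for better or worse).
* **Scope updates.** (i) Unforced, `𝕋³`, deterministic: `α < 1/3` is still the state of the art
  ("non-uniqueness of Leray–Hopf solutions to the fractional NSE with `0 < α < 1/3` was obtained"
  [cite: LangeRehmeierSchenke2024, §1, "State of the art: deterministic regime"]); nothing for
  `1/3 ≤ α ≤ 1` without force (for `α = 1` only the computer-assisted, unrefereed claim recorded
  at ns.S19, [cite: HouWangYang2025, Thm. 1]). (ii) WITH a force the exponent threshold disappears:
  two Leray–Hopf solutions from rest for all `β ∈ (0,2)` of `Λ^β` on `ℝ²`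
  [cite: AlbrittonColombo2023, Thm. 1.1], for `α ∈ (1/2, 5/4)` on `ℝ³`
  [cite: KhorMiaoSu2023, Thm. 1.2 and Rmk. 2 ("strongly rely on the equation having a forcing
  term")], and for `α = 1` [cite: AlbrittonBrueColombo2022AnnMath, Thm. 1.2]. (iii) Inside
  `α < 1/3`: `L²`-density of wild `C^β` data [cite: Gorini2023, §1].

Contents (all proved; no definition, no named fact): `HypodissipativeLerayNonuniquenessNarrow`
(global principle refuted, `α < 1/3`), `hypodissipativeLerayNonuniqueness_not_unique` (the same
from the catalogue fact as a hypothesis — the normal form of what the entry blocks),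
`HypodissipativeLerayNonuniquenessNarrow_local` (local principle with the strong energy
inequality for all pairs of times, `α < 1/5`).

## References

* L. De Rosa, Comm. PDE 44 (2019), 335–365; arXiv:1801.10235, §1 Thm. 1.2, §2 Thm. 2.1 and proof
  of Thm. 1.2 (p. 5). [`Derosa2018`]
* M. Colombo, C. De Lellis, L. De Rosa, Comm. Math. Phys. 362 (2018), 659–688; arXiv:1708.05666,
  §1 Thms. 1.1–1.3, p. 4. [`ColomboDelellisDerosa2018`]
* E. Wiedemann, *Weak-strong uniqueness in fluid dynamics*, LMS Lecture Note Ser. 452 (2018),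
  289–326, §2 Thm. 1. [`Wiedemann2018`]
* M. Gorini, J. Funct. Anal. 284 (2023), 109819; arXiv:2111.11173, §1. [`Gorini2023`]
* H. Kwon, W. S. Ożański, J. Funct. Anal. 282 (2022), 109370; arXiv:2010.12105, §1 pp. 3, 6,
  §2.4. [`KwonOzanski2022`]
* A. Bulut, M. K. Huynh, S. Palasek, arXiv:2201.05600 (2022), §1 Thm. 1. [`BulutHuynhPalasek2022`]
* T. Lange, M. Rehmeier, A. Schenke, arXiv:2412.16532 (2024), §1. [`LangeRehmeierSchenke2024`]
* D. Albritton, M. Colombo, Comm. Math. Phys. 402 (2023), 429–446, Thm. 1.1. [`AlbrittonColombo2023`]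
* C. Khor, C. Miao, X. Su, Bull. Lond. Math. Soc. 55 (2023), 2705–2717, Thm. 1.2, Rmks. 1–3.
  [`KhorMiaoSu2023`]
* D. Albritton, E. Brué, M. Colombo, Ann. of Math. 196 (2022), Thm. 1.2.
  [`AlbrittonBrueColombo2022AnnMath`]
* T. Y. Hou, Y. Wang, C. Yang, arXiv:2509.25116 (2025), Thm. 1 (claim). [`HouWangYang2025`]
-/

noncomputable section

open MeasureTheory Set Function
open scoped ENNReal NNReal

namespace Literature.Barriers.NavierStokesRegularity

/-- **The global uniqueness principle refuted by the entry (sharpest formal form, unconditional).**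
For every `α ∈ (0, 1/3)` it is FALSE that Leray solutions of
`∂ₜv + div(v ⊗ v) + ∇p + (-Δ)^α v = 0` on `𝕋³` (`Torus.IsLerayFracSolution α u₀`: distributional
solution with datum `u₀`, `L^∞(ℝ⁺;L²) ∩ L²_loc(ℝ⁺;H^α)`, energy inequality (2) from `0` for every
`t ≥ 0` and (3) from a.e. `s > 0`) from a common divergence-free `L²` datum agree modulo
space–time null sets on `(0,∞) × 𝕋³`. Nothing is assumed on the datum beyond `L²` and weak
incompressibility: THIS is the quantifier the barrier bites on (for data launching a `C¹`
solution the relative-energy argument gives uniqueness for every `α ≥ 0`, Wiedemann 2018 Thm. 1,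
see the module docstring). Proof: De Rosa's Thm. 1.2, discharged in the tree
(`DeRosa2019_thm12_holds`), supplies a datum with a sequence of pairwise a.e.-distinct Leray
solutions; apply the principle to the first two. [cite: Derosa2018, §1 Thm. 1.2] -/
theorem HypodissipativeLerayNonuniquenessNarrow {α : ℝ} (hα : 0 < α) (hα3 : α < 1 / 3) :
    ¬ (∀ (u₀ : UnitAddTorus (Fin 3) → EuclideanSpace ℝ (Fin 3))
        (v w : ℝ → UnitAddTorus (Fin 3) → EuclideanSpace ℝ (Fin 3)), MemLp u₀ 2 volume →
        Literature.Analysis.FunctionSpaces.Torus.IsWeaklyDivFree u₀ →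
        Literature.Analysis.FluidPDE.Torus.IsLerayFracSolution α u₀ v →
        Literature.Analysis.FluidPDE.Torus.IsLerayFracSolution α u₀ w →
        ∫⁻ t in Ioi 0, Literature.Analysis.FluidPDE.Torus.eL2NormSq (v t - w t) = 0) := by
  intro huniq
  obtain ⟨u₀, hu₀, hdiv, v, hv, hdist⟩ := DeRosa2019_thm12_holds α hα hα3
  exact hdist 0 1 zero_ne_one (huniq u₀ (v 0) (v 1) hu₀ hdiv (hv 0) (hv 1))

/-- **Normal form of what the catalogue entry blocks.** The entry
`HypodissipativeLerayNonuniqueness` (= `DeRosa2019_thm12`) implies, for each `α ∈ (0, 1/3)`, the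
failure of the uniqueness principle of `HypodissipativeLerayNonuniquenessNarrow` — and this
implication uses nothing else; any uniqueness statement it is invoked against must therefore
quantify over ALL divergence-free `L²` data (or at least contain a wild datum) and over the Leray
class as transcribed (energy inequality (3) from a.e. `s`). [cite: Derosa2018, §1 Thm. 1.2] -/
theorem hypodissipativeLerayNonuniqueness_not_unique (h : HypodissipativeLerayNonuniqueness)
    {α : ℝ} (hα : 0 < α) (hα3 : α < 1 / 3) :
    ∃ (u₀ : UnitAddTorus (Fin 3) → EuclideanSpace ℝ (Fin 3))
        (v w : ℝ → UnitAddTorus (Fin 3) → EuclideanSpace ℝ (Fin 3)), MemLp u₀ 2 volume ∧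
      Literature.Analysis.FunctionSpaces.Torus.IsWeaklyDivFree u₀ ∧
      Literature.Analysis.FluidPDE.Torus.IsLerayFracSolution α u₀ v ∧
      Literature.Analysis.FluidPDE.Torus.IsLerayFracSolution α u₀ w ∧
      ∫⁻ t in Ioi 0, Literature.Analysis.FluidPDE.Torus.eL2NormSq (v t - w t) ≠ 0 := by
  obtain ⟨u₀, hu₀, hdiv, v, hv, hdist⟩ := h α hα hα3
  exact ⟨u₀, v 0, v 1, hu₀, hdiv, hv 0, hv 1, hdist 0 1 zero_ne_one⟩

/-- **The local uniqueness principle refuted, with the strong energy inequality for ALL pairs of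
times (unconditional, `α < 1/5` in the tree).** For every `α ∈ (0, 1/5)` it is FALSE that two
distributional solutions of the fractional system on a slab `𝕋³ × (0,T)` which are continuous on
`[0,T] × 𝕋³`, uniformly `β`-Hölder in space for some `α < β < 1/5`, attain the same
divergence-free `C^β` datum exactly at `t = 0`, and satisfy the energy inequality
`½∫|v(t)|² + ∫ₛᵗ∫|(-Δ)^{α/2}v|² ≤ ½∫|v(s)|²` for ALL `0 ≤ s ≤ t ≤ T`, coincide on `[0,T]`. So
requiring the energy inequality from every time (De Rosa's Leray–Hopf class, his (2)) or
continuity / Hölder regularity below the Onsager exponent is not an evasion of the entry. Proof: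
Colombo–De Lellis–De Rosa's Thm. 1.3, discharged in the tree
(`ColomboDeLellisDeRosa2018_thm13_holds`), gives such a datum with a sequence of solutions
pairwise different at some time of `[0,T]`; apply the principle to the first two. (In print the
same holds for `α < 1/3`, De Rosa 2019 Thm. 1.2 (a), whose local form is not a separate in-tree
statement.) [cite: ColomboDelellisDerosa2018, §1 Thm. 1.3] [cite: Derosa2018, §1 Thm. 1.2 (a)] -/
theorem HypodissipativeLerayNonuniquenessNarrow_local {α : ℝ} (hα : 0 < α) (hα5 : α < 1 / 5) :
    ¬ (∀ (β : ℝ≥0) (T : ℝ) (u₀ : UnitAddTorus (Fin 3) → EuclideanSpace ℝ (Fin 3))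
        (v w : ℝ → UnitAddTorus (Fin 3) → EuclideanSpace ℝ (Fin 3)),
        α < (β : ℝ) → (β : ℝ) < 1 / 5 → 0 < T → MemLp u₀ 2 volume →
        Literature.Analysis.FunctionSpaces.Torus.IsWeaklyDivFree u₀ → MemHolder β u₀ →
        ContinuousOn (uncurry v) (Icc 0 T ×ˢ univ) → ContinuousOn (uncurry w) (Icc 0 T ×ˢ univ) →
        (∃ C : ℝ≥0, ∀ t ∈ Icc 0 T, HolderWith C β (v t)) →
        (∃ C : ℝ≥0, ∀ t ∈ Icc 0 T, HolderWith C β (w t)) →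
        v 0 = u₀ → w 0 = u₀ →
        Literature.Analysis.FluidPDE.Torus.IsWeakFracNSSolutionOn T α 1 v →
        Literature.Analysis.FluidPDE.Torus.IsWeakFracNSSolutionOn T α 1 w →
        (∀ s t, 0 ≤ s → s ≤ t → t ≤ T → Literature.Analysis.FluidPDE.Torus.FracEnergyIneq α v s t) →
        (∀ s t, 0 ≤ s → s ≤ t → t ≤ T → Literature.Analysis.FluidPDE.Torus.FracEnergyIneq α w s t) →
        ∀ t ∈ Icc 0 T, v t = w t) := by
  intro huniq
  obtain ⟨u₀, β, T, v, hu₀, hdiv, hαβ, hβ5, hHol, hT, hcont, hslice, h0, hweak, hdist, hEI⟩ :=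
    ColomboDeLellisDeRosa2018_thm13_holds α hα hα5
  obtain ⟨t, ht, hne⟩ := hdist 0 1 zero_ne_one
  exact hne (huniq β T u₀ (v 0) (v 1) hαβ hβ5 hT hu₀ hdiv hHol (hcont 0) (hcont 1) (hslice 0)
    (hslice 1) (h0 0) (h0 1) (hweak 0) (hweak 1) (hEI 0) (hEI 1) t ht)

end Literature.Barriers.NavierStokesRegularity
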